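import Mathlib

/-!
# `T4Continuum.ShellMeasureLandauDerivativeDecay` — WALL §2 (a) item (P4): the DISPLAYED binder (73) of
# [Balaban1985Variational] DERIVED FROM THE FIXED-POINT EQUATION — B11 Sect. C (63)–(73), the pseudo-locality
# (exponential decay) of the derivative kernel `𝔇(A′; c, b)` of the Landau correction `D`, as ONE abstract theorem on
# finite index sets with a pseudo-metric weight (cell `pub-balaban`, sub-cell `t4`, spine estimate NE7c (node U5b);
# NE7c ROUND-2 crew, unit `b2b-balaban-t4-ne7c-formalise-leaf-08` gen 12, owner table `LEAVES-NE7c-P1.md`, offer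
# journalled «(73) FROM THE FIXED-POINT EQUATION»; imports Mathlib ONLY; [folklore]; one DATA def (`entry`, the
# kernel entry of a continuous linear map between finite pi types), 0 `def … : Prop`, 0 sorry)

HONEST FRAMING.  Finite four-torus programme, rung (B)+1 only — NOT infinite volume, NOT a mass gap, NOT the Clay
problem, NOT summit progress; (B), `BetaPertHyp`, (B^μ) are not consumed.  NE7c (`T4IndicatorShell.ShellWeightBound`)
is NOT PRINTED and NOT PROVED; «NE7c ⇐ the named binders» (WALL `t4/b2b-balaban-t4-ne7c-p1/WALL-NE7c-P1.md` §2).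
Elementary calculus and finite sums on OUR side; nothing printed is asserted or cited as a fact.  HONEST DEPENDENCY
(cell): continuum YM on T⁴ ⇐ BetaPertH ∧ nine spine estimates (0/9 proved); BetaPertH ⇐ (D1) ∧ (D4) ∧ CAP+tail;
G-an2-4 gates asym, D1 and NE2/3/4.

THE POINT.  Row S66 (owner f2a∕f2b `ShellMeasureGradientTailPairing` p221557 ∕ `ShellMeasureGradientTailHDLocal`
p221786) types the `HD`-terms of (80) PER BOND over COLUMN-SUM binders of the single-bond derivative kernels of
`M = H ∘ D` (`hM'`, `hM₃'`); the crew's f3 (`ShellMeasureDecayKernelSums` p221973 + f3b) turns a DISPLAYED decay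
`‖kernel entry‖ ≤ prefactor · e^{−δ·distance}` into those binders.  For `D` that displayed decay is (73), p. 289:
*«|𝔇(A′; c, b)| ≤ O(1)C₃ε₃(Lʲη)^{−d+1}e^{−(1∕2)δ₀d(c₋,y)}, b ∈ Bʲ(y), y ∈ Λ_j»*, and print DERIVES it (pp. 287–289;
renders `b2b-balaban-ref1/pages/1985-cmp102-variational-background/…-p011∕p012∕p013-x2.png` READ AS IMAGES by
this seat): (63)–(64) the kernel `𝔇(A′; c, b) = (δ∕δA′(b))D(A′, c)` (*«The functions δA′ are defined at bonds of Ω₀,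
and values of this linear operator are functions defined at bonds of 𝔅_k»*); (65)–(68) differentiating the
fixed-point identity (49) `D(A′) = C(A′ − HD(A′))` (the scaling `Lʲη` absorbed in `C`) gives *«[I + Lʲη⟨(δC_j∕δA)(Lʲη(A′
− HD(A′))), H⟩]𝔇(A′) = Lʲη(δC_j∕δA)(Lʲη(A′ − HD(A′))) on Λ_j. (68) … this equation is an equation on 𝔇 as a function
of the variable c ∈ 𝔅_k. The variable b is fixed and treated as a parameter»*; (69) the bracket's kernel is
`≤ 9C₂B₀ε₃(Lʲ′η)^{−d}e^{−δ₀d(c₋,c′₋)}`; (70)–(71) Neumann inversion, `|(I + 𝔑)⁻¹(c, c′)| ≤ (1 − 9C₂B₀ε₃dc₁(½))⁻¹(Lʲ′η)^{−d}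
e^{−(1∕2)δ₀d(c₋,c′₋)}` ([3] Lemma 2.1); (72) `|Lʲη(δC_j∕δA)(…)| ≤ Lʲη(Lʲη)^{−d}C₃2ε₃` ([4] Prop. 5); hence (73).  THIS FILE
proves the SHAPE of that derivation with every input a TYPED HYPOTHESIS of earlier-paper type:
* §1 THE A-PRIORI WEIGHTED COLUMN BOUND (pure real inequality — NO Neumann series is needed for the bound, only for
  existence, and existence of `𝔇` is the differentiability of `D`): `m c ≤ r c + Σ_{c′} n c c′·m c′`,
  `Σ_{c′} n c c′·W c c′ ≤ q < 1`, `r c·w c ≤ ρ`, `w c ≤ W c c′·w c′` ⟹ `m c·w c ≤ ρ∕(1 − q)` — (71)'s constant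
  `(1 − q)⁻¹` with `b` a parameter (`weighted_le_of_le_add_sum`).
* §2 kernel ENTRIES of a continuous linear map between finite pi types (`entry T c b : 𝔄 →L 𝔅`, the (64) object),
  `apply_eq_sum_entry`, majorant bookkeeping, and the (69)-TYPE composition `majorant (𝒞 ∘ H) ≤ γ ⋆ h` with WEIGHTED
  row sum `≤ γ_w·h_w` under the triangle inequality (`weightedRowSum_comp_le`) — how a LOCAL bounded derivative of
  the averaging map's nonlinear part ((72), [4] Prop. 5 TYPE) and a (46)-TYPE decaying `H` ([5] Thm 3.12 — the deep
  wall, DISPLAYED) produce the small number `q`.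
* §3 THE CHAIN-RULE IDENTITY (68) on abstract normed spaces: `HasFDerivAt D 𝔇 A′`, `HasFDerivAt C 𝒞 (A′ − H(D A′))`,
  `D = C ∘ (id − H ∘ D)` near `A′` ⟹ `𝔇 + (𝒞 ∘L H) ∘L 𝔇 = 𝒞` (`fderiv_fixedPoint_identity`).
* §4 (73) TYPE (`norm_entry_le_of_identity`, `landauDerivative_decay`; `opNorm_entry_le_of_decay`, `colSum_le_of_decay`):
  with a (69)-TYPE majorant of `𝒞 ∘L H` whose `e^{δ·d}`-weighted row sums are `≤ q < 1` and a (72)-TYPE weighted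
  bound `‖𝒞(ι_b a) c‖·e^{δ·d(c,b)} ≤ ρ‖a‖`, every entry obeys **`‖𝔇(ι_b a) c‖ ≤ ρ∕(1 − q)·e^{−δ·d(c,b)}·‖a‖`** — (73)'s
  SHAPE, `b` FIXED AS A PARAMETER as on p. 288, for ANY finite index types `σ` (coarse bonds: values of `C`, `D`) and
  `β` (fine bonds: arguments), any placement into a set with a pseudo-metric `d`, any scalar field `RCLike 𝕜`.
* §5 NON-VACUITY: a one-point instance in which every hypothesis is met (bound attained up to `(1 − q)⁻¹(1 + q)`).
NOT HERE (said): the `𝔇₂` remark of p. 289 («(73) with ε₃² instead of ε₃» after subtracting the linear term — S66's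
`M₃ = HD₃` source); the lattice numbers `dc₁(½)` ∕ `C(δ, d)` (crew f3a, by name at the junction); the conversion into
f2b's `hM'` (crew f3b); any identification of `C`, `H`, `D` with Bałaban's sectioned objects ([dict], node O); (46),
(72), (54)-smallness themselves — they stay DISPLAYED-TYPE binders, now the ONLY ones behind (73).  No estimate of
Bałaban's at a live level is discharged; NOTHING in the countdown moves.
-/

noncomputable section

open Metric Set Filter Finset
open scoped Topology

namespace Summit.QuantumFields.BalabanUV.T4Continuum.ShellMeasureLandauDerivativeDecay

/-! ## §1 The a-priori weighted column bound ((68) + (69) + (72) ⇒ (71)∕(73), `b` a parameter; no Neumann series) -/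

section APriori

variable {σ : Type*} [Fintype σ]

/-- **THE A-PRIORI WEIGHTED BOUND.**  On a finite index set, if `0 ≤ m c ≤ r c + Σ_{c′} n c c′·m c′` (the entrywise form
of (68) for a fixed fine bond `b`), the majorant `n ≥ 0` has WEIGHTED row sums `Σ_{c′} n c c′·W c c′ ≤ q < 1` ((69) +
[3] Lemma 2.1 TYPE), `r c·w c ≤ ρ` ((72) TYPE + locality) and `w c ≤ W c c′·w c′` (triangle inequality of `e^{δd}`),
then `m c·w c ≤ ρ∕(1 − q)` for every `c` — (71)'s constant.  Proof: evaluate at a maximiser of `m·w`. [folklore] -/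
theorem weighted_le_of_le_add_sum (m r w : σ → ℝ) (n W : σ → σ → ℝ) {q ρ : ℝ}
    (hm0 : ∀ c, 0 ≤ m c) (hn0 : ∀ c c', 0 ≤ n c c') (hw0 : ∀ c, 0 ≤ w c) (hW0 : ∀ c c', 0 ≤ W c c')
    (htri : ∀ c c', w c ≤ W c c' * w c')
    (hm : ∀ c, m c ≤ r c + ∑ c', n c c' * m c')
    (hq : ∀ c, ∑ c', n c c' * W c c' ≤ q) (hq1 : q < 1)
    (hr : ∀ c, r c * w c ≤ ρ) :
    ∀ c, m c * w c ≤ ρ / (1 - q) := by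
  intro c₁
  obtain ⟨c₀, -, hc₀⟩ :=
    Finset.exists_max_image (Finset.univ : Finset σ) (fun c => m c * w c) ⟨c₁, Finset.mem_univ _⟩
  set S := m c₀ * w c₀ with hS
  have hle : ∀ c, m c * w c ≤ S := fun c => hc₀ c (Finset.mem_univ c)
  have hS0 : 0 ≤ S := mul_nonneg (hm0 c₀) (hw0 c₀)
  -- the key estimate at the maximiser: `S ≤ ρ + q·S`
  have h2 : (∑ c', n c₀ c' * m c') * w c₀ ≤ q * S := by
    rw [Finset.sum_mul]
    calc ∑ c', n c₀ c' * m c' * w c₀ ≤ ∑ c', n c₀ c' * W c₀ c' * S := by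
          refine Finset.sum_le_sum fun c' _ => ?_
          calc n c₀ c' * m c' * w c₀ ≤ n c₀ c' * m c' * (W c₀ c' * w c') :=
                mul_le_mul_of_nonneg_left (htri c₀ c') (mul_nonneg (hn0 _ _) (hm0 _))
            _ = n c₀ c' * W c₀ c' * (m c' * w c') := by ring
            _ ≤ n c₀ c' * W c₀ c' * S := mul_le_mul_of_nonneg_left (hle c') (mul_nonneg (hn0 _ _) (hW0 _ _))
      _ = (∑ c', n c₀ c' * W c₀ c') * S := by rw [Finset.sum_mul]
      _ ≤ q * S := mul_le_mul_of_nonneg_right (hq c₀) hS0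
  have hkey : S ≤ ρ + q * S :=
    calc S ≤ (r c₀ + ∑ c', n c₀ c' * m c') * w c₀ := mul_le_mul_of_nonneg_right (hm c₀) (hw0 c₀)
      _ = r c₀ * w c₀ + (∑ c', n c₀ c' * m c') * w c₀ := by ring
      _ ≤ ρ + q * S := add_le_add (hr c₀) h2
  have hS' : S ≤ ρ / (1 - q) := by rw [le_div_iff₀ (by linarith)]; nlinarith
  exact (hle c₁).trans hS'

end APriori

/-! ## §2 Kernel entries of a continuous linear map between finite pi types; majorants; the (69)-TYPE composition -/

section Entries

variable {𝕜 : Type*} [RCLike 𝕜]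
variable {σ β : Type*} [Fintype σ] [Fintype β] [DecidableEq σ] [DecidableEq β]
variable {𝔄 𝔅 : Type*} [NormedAddCommGroup 𝔄] [NormedSpace 𝕜 𝔄] [NormedAddCommGroup 𝔅] [NormedSpace 𝕜 𝔅]

/-- THE KERNEL ENTRY of a continuous linear map `T : (β → 𝔄) →L (σ → 𝔅)` between finite pi types: the continuous linear
map `a ↦ (T (ι_b a))(c)` on the fibre — B11 (64) `𝔇(A′; c, b) = (δ∕δA′(b)) D(A′, c)` when `T = DD(A′)` (DATA).
[folklore] -/
def entry (T : (β → 𝔄) →L[𝕜] (σ → 𝔅)) (c : σ) (b : β) : 𝔄 →L[𝕜] 𝔅 :=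
  (ContinuousLinearMap.proj c).comp (T.comp (ContinuousLinearMap.single 𝕜 (fun _ : β => 𝔄) b))

omit [Fintype σ] [Fintype β] [DecidableEq σ] in
/-- Unfolding: `entry T c b a = T (ι_b a) c`. [folklore] -/
@[simp] theorem entry_apply (T : (β → 𝔄) →L[𝕜] (σ → 𝔅)) (c : σ) (b : β) (a : 𝔄) :
    entry T c b a = T (Pi.single b a) c := rfl

omit [Fintype σ] [DecidableEq σ] in
/-- A field is the sum of its single-bond parts, so `T X c = Σ_b entry T c b (X b)` — every continuous linear map between
finite pi types IS the operator of its kernel. [folklore] -/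
theorem apply_eq_sum_entry (T : (β → 𝔄) →L[𝕜] (σ → 𝔅)) (X : β → 𝔄) (c : σ) :
    T X c = ∑ b, entry T c b (X b) := by
  conv_lhs => rw [← Finset.univ_sum_single X, map_sum]
  simp [Finset.sum_apply]

omit [Fintype σ] [DecidableEq σ] in
/-- MAJORANT BOOKKEEPING: an entrywise bound `‖T (ι_b a) c‖ ≤ k c b·‖a‖` gives `‖T X c‖ ≤ Σ_b k c b·‖X b‖`.
[folklore] -/
theorem norm_apply_le_of_majorant (T : (β → 𝔄) →L[𝕜] (σ → 𝔅)) (k : σ → β → ℝ)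
    (hk : ∀ b a c, ‖T (Pi.single b a) c‖ ≤ k c b * ‖a‖) (X : β → 𝔄) (c : σ) :
    ‖T X c‖ ≤ ∑ b, k c b * ‖X b‖ := by
  rw [apply_eq_sum_entry]
  exact (norm_sum_le _ _).trans (Finset.sum_le_sum fun b _ => by simpa using hk b (X b) c)

variable {γ' : Type*} [Fintype γ'] [DecidableEq γ']
variable {ℭ : Type*} [NormedAddCommGroup ℭ] [NormedSpace 𝕜 ℭ]

omit [Fintype σ] [DecidableEq σ] [Fintype γ'] in
/-- (69)-TYPE COMPOSITION OF MAJORANTS: if `‖𝒞 (ι_{b′} a) c‖ ≤ γ c b′·‖a‖` and `‖H (ι_{c′} a) b′‖ ≤ h b′ c′·‖a‖` then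
`‖𝒞 (H (ι_{c′} a)) c‖ ≤ (Σ_{b′} γ c b′·h b′ c′)·‖a‖` — the kernel of the bracket of (68) is majorised by the product
kernel. [folklore] -/
theorem norm_comp_single_le (𝒞 : (β → 𝔄) →L[𝕜] (σ → 𝔅)) (H : (γ' → ℭ) →L[𝕜] (β → 𝔄))
    (γ : σ → β → ℝ) (h : β → γ' → ℝ)
    (hγ : ∀ b' a c, ‖𝒞 (Pi.single b' a) c‖ ≤ γ c b' * ‖a‖) (hγ0 : ∀ c b', 0 ≤ γ c b')
    (hh : ∀ c' a b', ‖H (Pi.single c' a) b'‖ ≤ h b' c' * ‖a‖)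
    (c' : γ') (a : ℭ) (c : σ) :
    ‖𝒞 (H (Pi.single c' a)) c‖ ≤ (∑ b', γ c b' * h b' c') * ‖a‖ := by
  calc ‖𝒞 (H (Pi.single c' a)) c‖ ≤ ∑ b', γ c b' * ‖H (Pi.single c' a) b'‖ :=
        norm_apply_le_of_majorant 𝒞 γ hγ _ c
    _ ≤ ∑ b', γ c b' * (h b' c' * ‖a‖) :=
        Finset.sum_le_sum fun b' _ => mul_le_mul_of_nonneg_left (hh c' a b') (hγ0 c b')
    _ = (∑ b', γ c b' * h b' c') * ‖a‖ := by rw [Finset.sum_mul]; simp [mul_assoc]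

omit [Fintype σ] [DecidableEq σ] [DecidableEq β] [DecidableEq γ'] in
/-- The weight `e^{δ·d}` of a pseudo-metric is SUBMULTIPLICATIVE along the triangle inequality (`δ ≥ 0`). [folklore] -/
theorem exp_weight_triangle {S : Type*} (d : S → S → ℝ) (htri : ∀ x y z, d x z ≤ d x y + d y z) {δ : ℝ}
    (hδ : 0 ≤ δ) (x y z : S) :
    Real.exp (δ * d x z) ≤ Real.exp (δ * d x y) * Real.exp (δ * d y z) := by
  rw [← Real.exp_add, Real.exp_le_exp, ← mul_add]
  exact mul_le_mul_of_nonneg_left (htri x y z) hδ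

omit [Fintype σ] [DecidableEq σ] [DecidableEq β] [DecidableEq γ'] in
/-- THE WEIGHTED ROW SUM OF A PRODUCT KERNEL under the triangle inequality of the placement pseudo-metric `d`:
`Σ_{c′} (Σ_{b′} γ c b′·h b′ c′)·e^{δd(c,c′)} ≤ γ_w·h_w` when `Σ_{b′} γ c b′·e^{δd(c,b′)} ≤ γ_w` (a LOCAL bounded
derivative: (72) TYPE) and `Σ_{c′} h b′ c′·e^{δd(b′,c′)} ≤ h_w` for every `b′` ((46) TYPE decay at a rate above `δ`; the
number `h_w ≥ 0` is the crew's f3a lattice sum) — the `q = γ_w·h_w` of (69)∕(71). [folklore] -/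
theorem weightedRowSum_comp_le {S : Type*} (d : S → S → ℝ) (htri : ∀ x y z, d x z ≤ d x y + d y z)
    (pσ : σ → S) (pβ : β → S) (pγ : γ' → S) {δ : ℝ} (hδ : 0 ≤ δ)
    (γ : σ → β → ℝ) (h : β → γ' → ℝ) (hγ0 : ∀ c b', 0 ≤ γ c b') (hh0 : ∀ b' c', 0 ≤ h b' c')
    {γw hw : ℝ} (hhw0 : 0 ≤ hw) (hγw : ∀ c, ∑ b', γ c b' * Real.exp (δ * d (pσ c) (pβ b')) ≤ γw)
    (hhw : ∀ b', ∑ c', h b' c' * Real.exp (δ * d (pβ b') (pγ c')) ≤ hw) (c : σ) :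
    ∑ c', (∑ b', γ c b' * h b' c') * Real.exp (δ * d (pσ c) (pγ c')) ≤ γw * hw := by
  have hE := exp_weight_triangle d htri hδ
  calc ∑ c', (∑ b', γ c b' * h b' c') * Real.exp (δ * d (pσ c) (pγ c'))
      = ∑ b', γ c b' * ∑ c', h b' c' * Real.exp (δ * d (pσ c) (pγ c')) := by
        simp_rw [Finset.sum_mul, Finset.mul_sum]
        rw [Finset.sum_comm]
        exact Finset.sum_congr rfl fun b' _ => Finset.sum_congr rfl fun c' _ => by ring
    _ ≤ ∑ b', γ c b' *
          ∑ c', h b' c' * (Real.exp (δ * d (pσ c) (pβ b')) * Real.exp (δ * d (pβ b') (pγ c'))) := by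
        refine Finset.sum_le_sum fun b' _ => mul_le_mul_of_nonneg_left ?_ (hγ0 c b')
        exact Finset.sum_le_sum fun c' _ => mul_le_mul_of_nonneg_left (hE _ _ _) (hh0 b' c')
    _ = ∑ b', γ c b' * Real.exp (δ * d (pσ c) (pβ b')) *
          ∑ c', h b' c' * Real.exp (δ * d (pβ b') (pγ c')) := by
        refine Finset.sum_congr rfl fun b' _ => ?_
        rw [mul_assoc, Finset.mul_sum, Finset.mul_sum, Finset.mul_sum]
        exact Finset.sum_congr rfl fun c' _ => by ring
    _ ≤ ∑ b', γ c b' * Real.exp (δ * d (pσ c) (pβ b')) * hw :=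
        Finset.sum_le_sum fun b' _ =>
          mul_le_mul_of_nonneg_left (hhw b') (mul_nonneg (hγ0 c b') (Real.exp_nonneg _))
    _ = (∑ b', γ c b' * Real.exp (δ * d (pσ c) (pβ b'))) * hw := by rw [Finset.sum_mul]
    _ ≤ γw * hw := mul_le_mul_of_nonneg_right (hγw c) hhw0

end Entries

/-! ## §3 The chain-rule identity (68) of the fixed-point equation (49)∕(59) -/

section ChainRule

variable {𝕜 : Type*} [RCLike 𝕜]
variable {EA EX : Type*} [NormedAddCommGroup EA] [NormedSpace 𝕜 EA] [NormedAddCommGroup EX] [NormedSpace 𝕜 EX]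

/-- **(68) FROM (49).**  If `D` is Fréchet-differentiable at `A′` with derivative `𝔇`, `C` is Fréchet-differentiable at
`Y = A′ − H(D A′)` with derivative `𝒞`, `H` is a continuous linear map and the FIXED-POINT IDENTITY
`D(x) = C(x − H(D x))` holds for `x` near `A′` (B11 (49) with the scaling absorbed in `C`; (59)–(61)), then
`𝔇 + (𝒞 ∘ H) ∘ 𝔇 = 𝒞` — B11 (65)–(68) *«an integral equation which can be obtained by differentiation of Eq. (49)»*,
by the chain rule and the uniqueness of the Fréchet derivative. [folklore] -/
theorem fderiv_fixedPoint_identity {D C : EA → EX} (H : EX →L[𝕜] EA) {A' : EA} {𝔇 𝒞 : EA →L[𝕜] EX}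
    (hD : HasFDerivAt D 𝔇 A') (hC : HasFDerivAt C 𝒞 (A' - H (D A')))
    (hfix : ∀ᶠ x in 𝓝 A', D x = C (x - H (D x))) :
    𝔇 + (𝒞.comp H).comp 𝔇 = 𝒞 := by
  -- derivative of `x ↦ x − H (D x)` at `A′`
  have hY : HasFDerivAt (fun x => x - H (D x)) (ContinuousLinearMap.id 𝕜 EA - H.comp 𝔇) A' :=
    (hasFDerivAt_id A').sub (H.hasFDerivAt.comp A' hD)
  -- chain rule for the right-hand side of (49)
  have hRHS : HasFDerivAt (fun x => C (x - H (D x))) (𝒞.comp (ContinuousLinearMap.id 𝕜 EA - H.comp 𝔇)) A' :=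
    hC.comp A' hY
  -- (49) near `A′` transports the derivative to `D`; uniqueness
  have hD' : HasFDerivAt D (𝒞.comp (ContinuousLinearMap.id 𝕜 EA - H.comp 𝔇)) A' :=
    hRHS.congr_of_eventuallyEq hfix
  have huniq : 𝔇 = 𝒞.comp (ContinuousLinearMap.id 𝕜 EA - H.comp 𝔇) := hD.unique hD'
  -- rearrange: 𝒞 ∘ (id − H𝔇) = 𝒞 − 𝒞H𝔇
  have hexp : 𝒞.comp (ContinuousLinearMap.id 𝕜 EA - H.comp 𝔇) = 𝒞 - (𝒞.comp H).comp 𝔇 := by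
    rw [ContinuousLinearMap.comp_sub, ContinuousLinearMap.comp_id, ContinuousLinearMap.comp_assoc]
  rw [hexp] at huniq
  exact eq_sub_iff_add_eq.mp huniq

end ChainRule

/-! ## §4 (73) TYPE: the exponential decay of the derivative kernel, `b` fixed as a parameter -/

section Decay

variable {𝕜 : Type*} [RCLike 𝕜]
variable {σ β : Type*} [Fintype σ] [Fintype β] [DecidableEq σ] [DecidableEq β]
variable {𝔄 : Type*} [NormedAddCommGroup 𝔄] [NormedSpace 𝕜 𝔄]

omit [Fintype β] in
/-- **THE OPERATOR-LEVEL BOUND** (the content of (70)–(71) as an a-priori estimate).  Let continuous linear maps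
`𝔇 R : (β → 𝔄) →L (σ → 𝔄)` and `N : (σ → 𝔄) →L (σ → 𝔄)` satisfy (68) `𝔇 + N ∘ 𝔇 = R`; let `N` have a majorant
`n ≥ 0` (`‖N(ι_{c′} a) c‖ ≤ n c c′·‖a‖`) with WEIGHTED row sums `Σ_{c′} n c c′·W c c′ ≤ q < 1` for weights `W ≥ 0`;
fix a fine bond `b` and weights `w ≥ 0` with `w c ≤ W c c′·w c′`; let the source obey `‖R(ι_b a) c‖·w c ≤ ρ‖a‖`.  Then
`‖𝔇(ι_b a) c‖·w c ≤ ρ∕(1 − q)·‖a‖` for all `a`, `c`. [folklore] -/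
theorem norm_entry_le_of_identity (𝔇 R : (β → 𝔄) →L[𝕜] (σ → 𝔄)) (N : (σ → 𝔄) →L[𝕜] (σ → 𝔄))
    (hid : 𝔇 + N.comp 𝔇 = R)
    (n W : σ → σ → ℝ) (hn : ∀ c' a c, ‖N (Pi.single c' a) c‖ ≤ n c c' * ‖a‖) (hn0 : ∀ c c', 0 ≤ n c c')
    (hW0 : ∀ c c', 0 ≤ W c c') {q : ℝ} (hq : ∀ c, ∑ c', n c c' * W c c' ≤ q) (hq1 : q < 1)
    (b : β) (w : σ → ℝ) (hw0 : ∀ c, 0 ≤ w c) (htri : ∀ c c', w c ≤ W c c' * w c')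
    {ρ : ℝ} (hr : ∀ a c, ‖R (Pi.single b a) c‖ * w c ≤ ρ * ‖a‖) (a : 𝔄) (c : σ) :
    ‖𝔇 (Pi.single b a) c‖ * w c ≤ ρ / (1 - q) * ‖a‖ := by
  set X : β → 𝔄 := Pi.single b a with hX
  -- entrywise form of (68) for the column `b`: `𝔇 X c = R X c − N (𝔇 X) c`
  have hcol : ∀ c, 𝔇 X c = R X c - N (𝔇 X) c := by
    intro c
    have h : 𝔇 X c + N (𝔇 X) c = R X c := congrFun (DFunLike.congr_fun hid X) c
    exact eq_sub_of_add_eq h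
  have hm : ∀ c, ‖𝔇 X c‖ ≤ ‖R X c‖ + ∑ c', n c c' * ‖𝔇 X c'‖ := by
    intro c
    rw [hcol c]
    exact (norm_sub_le _ _).trans (add_le_add le_rfl (norm_apply_le_of_majorant N n hn (𝔇 X) c))
  have key := weighted_le_of_le_add_sum (fun c => ‖𝔇 X c‖) (fun c => ‖R X c‖) w n W
    (fun c => norm_nonneg _) hn0 hw0 hW0 htri hm hq hq1 (fun c => hr a c) c
  calc ‖𝔇 X c‖ * w c ≤ ρ * ‖a‖ / (1 - q) := key
    _ = ρ / (1 - q) * ‖a‖ := by ring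

/-- **(73) TYPE — `landauDerivative_decay`.**  On finite index sets `σ` (coarse bonds, where `C` and `D` take values) and
`β` (fine bonds, their arguments), placed by `pσ`, `pβ` in a set `S` with a pseudo-metric `d` (triangle inequality; e.g.
B4∕B6's block distance `d(c₋, y)`), let `D, C : (β → 𝔄) → (σ → 𝔄)` and a continuous linear `H : (σ → 𝔄) → (β → 𝔄)`
satisfy near `A′` the FIXED-POINT IDENTITY `D(x) = C(x − H(D x))` ((49)), `D`, `C` Fréchet-differentiable at `A′`,
`A′ − H(D A′)` with derivatives `𝔇`, `𝒞`.  Assume the (69) TYPE majorant: `‖𝒞(H(ι_{c′} a)) c‖ ≤ n c c′·‖a‖`, `n ≥ 0`,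
with `e^{δd}`-WEIGHTED row sums `≤ q < 1` ([3] Lemma 2.1's role), and for the fixed fine bond `b` the (72) TYPE + locality
bound `‖𝒞(ι_b a) c‖·e^{δ·d(c,b)} ≤ ρ‖a‖` ([4] Prop. 5's role).  Then for every `a` and every coarse bond `c`:
`‖𝔇(ι_b a) c‖ ≤ ρ∕(1 − q)·e^{−δ·d(c,b)}·‖a‖` — B11 (73)'s SHAPE with (71)'s constant, `b` treated as a parameter as on
p. 288.  Nothing of Bałaban's is asserted: (46)∕(69), (72), `q < 1` enter as TYPED HYPOTHESES. [folklore] -/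
theorem landauDerivative_decay {S : Type*} (d : S → S → ℝ) (htri : ∀ x y z, d x z ≤ d x y + d y z)
    (pσ : σ → S) (pβ : β → S) {δ : ℝ} (hδ : 0 ≤ δ)
    {D C : (β → 𝔄) → (σ → 𝔄)} (H : (σ → 𝔄) →L[𝕜] (β → 𝔄)) {A' : β → 𝔄} {𝔇 𝒞 : (β → 𝔄) →L[𝕜] (σ → 𝔄)}
    (hD : HasFDerivAt D 𝔇 A') (hC : HasFDerivAt C 𝒞 (A' - H (D A')))
    (hfix : ∀ᶠ x in 𝓝 A', D x = C (x - H (D x)))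
    (n : σ → σ → ℝ) (hn0 : ∀ c c', 0 ≤ n c c')
    (hn : ∀ c' a c, ‖𝒞 (H (Pi.single c' a)) c‖ ≤ n c c' * ‖a‖)
    {q : ℝ} (hq : ∀ c, ∑ c', n c c' * Real.exp (δ * d (pσ c) (pσ c')) ≤ q) (hq1 : q < 1)
    (b : β) {ρ : ℝ} (hr : ∀ a c, ‖𝒞 (Pi.single b a) c‖ * Real.exp (δ * d (pσ c) (pβ b)) ≤ ρ * ‖a‖)
    (a : 𝔄) (c : σ) :
    ‖𝔇 (Pi.single b a) c‖ ≤ ρ / (1 - q) * Real.exp (-(δ * d (pσ c) (pβ b))) * ‖a‖ := by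
  have hid : 𝔇 + (𝒞.comp H).comp 𝔇 = 𝒞 := fderiv_fixedPoint_identity H hD hC hfix
  have key := norm_entry_le_of_identity 𝔇 𝒞 (𝒞.comp H) hid n
    (fun c c' => Real.exp (δ * d (pσ c) (pσ c')))
    (fun c' a c => by simpa using hn c' a c) hn0 (fun _ _ => Real.exp_nonneg _) hq hq1 b
    (fun c => Real.exp (δ * d (pσ c) (pβ b))) (fun _ => Real.exp_nonneg _)
    (fun c c' => exp_weight_triangle d htri hδ _ _ _) hr a c
  have hpos : 0 < Real.exp (δ * d (pσ c) (pβ b)) := Real.exp_pos _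
  rw [Real.exp_neg]
  rw [← le_div_iff₀ hpos] at key
  simpa [div_eq_mul_inv, mul_assoc, mul_comm, mul_left_comm] using key

/-- **(73) FROM THE THREE PRINTED-TYPE INPUTS IN ONE CALL.**  Majorants `γ ≥ 0` of `𝒞 = DC(Y)` (`‖𝒞(ι_{b′} a) c‖ ≤
γ c b′·‖a‖`, LOCAL and bounded: `e^{δd}`-weighted row sums `≤ γ_w` — (72)∕[4] Prop. 5 TYPE) and `h ≥ 0` of `H`
(`‖H(ι_{c′} a) b′‖ ≤ h b′ c′·‖a‖`, weighted row sums `≤ h_w` — (46)∕[5] Thm 3.12 TYPE, decay at a rate above `δ`) with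
the smallness `γ_w·h_w < 1` ((54)∕(71) TYPE) give `‖𝔇(ι_b a) c‖ ≤ γ_w∕(1 − γ_w h_w)·e^{−δ·d(c,b)}·‖a‖` for ALL `b`, `c`.
(The (72)-TYPE column bound is a single term of the weighted row sum.) [folklore] -/
theorem landauDerivative_decay_of_majorants {S : Type*} (d : S → S → ℝ) (htri : ∀ x y z, d x z ≤ d x y + d y z)
    (pσ : σ → S) (pβ : β → S) {δ : ℝ} (hδ : 0 ≤ δ)
    {D C : (β → 𝔄) → (σ → 𝔄)} (H : (σ → 𝔄) →L[𝕜] (β → 𝔄)) {A' : β → 𝔄} {𝔇 𝒞 : (β → 𝔄) →L[𝕜] (σ → 𝔄)}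
    (hD : HasFDerivAt D 𝔇 A') (hC : HasFDerivAt C 𝒞 (A' - H (D A')))
    (hfix : ∀ᶠ x in 𝓝 A', D x = C (x - H (D x)))
    (γ : σ → β → ℝ) (h : β → σ → ℝ) (hγ0 : ∀ c b', 0 ≤ γ c b') (hh0 : ∀ b' c', 0 ≤ h b' c')
    (hγ : ∀ b' a c, ‖𝒞 (Pi.single b' a) c‖ ≤ γ c b' * ‖a‖)
    (hh : ∀ c' a b', ‖H (Pi.single c' a) b'‖ ≤ h b' c' * ‖a‖)
    {γw hw : ℝ} (hhw0 : 0 ≤ hw) (hγw : ∀ c, ∑ b', γ c b' * Real.exp (δ * d (pσ c) (pβ b')) ≤ γw)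
    (hhw : ∀ b', ∑ c', h b' c' * Real.exp (δ * d (pβ b') (pσ c')) ≤ hw) (hq1 : γw * hw < 1)
    (b : β) (a : 𝔄) (c : σ) :
    ‖𝔇 (Pi.single b a) c‖ ≤ γw / (1 - γw * hw) * Real.exp (-(δ * d (pσ c) (pβ b))) * ‖a‖ :=
  landauDerivative_decay d htri pσ pβ hδ H hD hC hfix (fun c c' => ∑ b', γ c b' * h b' c')
    (fun _ _ => Finset.sum_nonneg fun _ _ => mul_nonneg (hγ0 _ _) (hh0 _ _))
    (fun c' a c => by simpa using norm_comp_single_le 𝒞 H γ h hγ hγ0 hh c' a c)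
    (weightedRowSum_comp_le d htri pσ pβ pσ hδ γ h hγ0 hh0 hhw0 hγw hhw) hq1 b
    (fun a c => by
      calc ‖𝒞 (Pi.single b a) c‖ * Real.exp (δ * d (pσ c) (pβ b))
          ≤ γ c b * ‖a‖ * Real.exp (δ * d (pσ c) (pβ b)) :=
            mul_le_mul_of_nonneg_right (hγ b a c) (Real.exp_nonneg _)
        _ = γ c b * Real.exp (δ * d (pσ c) (pβ b)) * ‖a‖ := by ring
        _ ≤ (∑ b', γ c b' * Real.exp (δ * d (pσ c) (pβ b'))) * ‖a‖ :=
            mul_le_mul_of_nonneg_right (Finset.single_le_sum (f := fun b' => γ c b' * Real.exp (δ * d (pσ c) (pβ b')))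
              (fun b' _ => mul_nonneg (hγ0 c b') (Real.exp_nonneg _)) (Finset.mem_univ b)) (norm_nonneg _)
        _ ≤ γw * ‖a‖ := mul_le_mul_of_nonneg_right (hγw c) (norm_nonneg _))
    a c

omit [Fintype σ] [Fintype β] [DecidableEq σ] in
/-- The (73) bound as an OPERATOR-NORM bound on the (64) entry `𝔇(A′; c, b) = entry 𝔇 c b` — the form the crew's f3a
(`ShellMeasureDecayKernelSums.colSum_le_of_decay` ∕ `rowSum_le_of_decay`) consumes: a pointwise decay bound with
`K ≥ 0` (e.g. `K = ρ∕(1 − q)` from `landauDerivative_decay`) gives `‖entry 𝔇 c b‖ ≤ K·e^{−δ·d(c,b)}`. [folklore] -/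
theorem opNorm_entry_le_of_decay {S : Type*} (d : S → S → ℝ) (pσ : σ → S) (pβ : β → S) (δ : ℝ)
    (𝔇 : (β → 𝔄) →L[𝕜] (σ → 𝔄)) (b : β) {K : ℝ} (hK : 0 ≤ K)
    (hdec : ∀ a c, ‖𝔇 (Pi.single b a) c‖ ≤ K * Real.exp (-(δ * d (pσ c) (pβ b))) * ‖a‖) (c : σ) :
    ‖entry 𝔇 c b‖ ≤ K * Real.exp (-(δ * d (pσ c) (pβ b))) :=
  ContinuousLinearMap.opNorm_le_bound _ (mul_nonneg hK (Real.exp_nonneg _)) fun a => by simpa using hdec a c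

omit [Fintype β] [DecidableEq σ] in
/-- COLUMN SUM of the derivative kernel at the fine bond `b` (the quantity behind f2b's `hM'` once composed with a
(46)-TYPE `H`): `Σ_c ‖𝔇(ι_b a) c‖ ≤ K·(Σ_c e^{−δ·d(c,b)})·‖a‖` — the remaining lattice sum is the crew's f3a number,
uniform in the volume. [folklore] -/
theorem colSum_le_of_decay {S : Type*} (d : S → S → ℝ) (pσ : σ → S) (pβ : β → S) (δ : ℝ)
    (𝔇 : (β → 𝔄) →L[𝕜] (σ → 𝔄)) (b : β) {K : ℝ}
    (hdec : ∀ a c, ‖𝔇 (Pi.single b a) c‖ ≤ K * Real.exp (-(δ * d (pσ c) (pβ b))) * ‖a‖) (a : 𝔄) :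
    ∑ c, ‖𝔇 (Pi.single b a) c‖ ≤ K * (∑ c, Real.exp (-(δ * d (pσ c) (pβ b)))) * ‖a‖ := by
  rw [Finset.mul_sum, Finset.sum_mul]
  exact Finset.sum_le_sum fun c _ => hdec a c

end Decay

/-! ## §5 Non-vacuity: a one-point instance where every hypothesis is met -/

section Toy

/-- ONE coarse bond, ONE fine bond, scalar fibre `ℂ`, `H = t·id` (`0 ≤ t`), `C(A) = s·A` (`0 ≤ s`, the linear toy of the
averaging map's derivative), `D(A′) = (s∕(1 + s t))·A′` — which DOES satisfy the fixed-point identity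
`D(x) = C(x − H(D x))` everywhere; with `d ≡ 0`, `δ = 0`, `n ≡ s t = q < 1`, `ρ = s` every hypothesis of
`landauDerivative_decay` holds, and its conclusion reads `s∕(1 + s t) ≤ s∕(1 − s t)`.  So the binder shapes are jointly
inhabited (instantiable, not vacuity-prone). [folklore] -/
example (s t : ℝ) (hs : 0 ≤ s) (ht : 0 ≤ t) (hst : s * t < 1) (a : ℂ) :
    ‖(((s / (1 + s * t) : ℝ) : ℂ) • ContinuousLinearMap.id ℂ (Unit → ℂ)) (Pi.single () a) ()‖
      ≤ s / (1 - s * t) * ‖a‖ := by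
  have hst0 : 0 ≤ s * t := mul_nonneg hs ht
  let H : (Unit → ℂ) →L[ℂ] (Unit → ℂ) := (t : ℂ) • ContinuousLinearMap.id ℂ (Unit → ℂ)
  let 𝒞 : (Unit → ℂ) →L[ℂ] (Unit → ℂ) := (s : ℂ) • ContinuousLinearMap.id ℂ (Unit → ℂ)
  let 𝔇 : (Unit → ℂ) →L[ℂ] (Unit → ℂ) := ((s / (1 + s * t) : ℝ) : ℂ) • ContinuousLinearMap.id ℂ (Unit → ℂ)
  have h1st' : (1 : ℂ) + (s : ℂ) * (t : ℂ) ≠ 0 := by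
    have h : (1 + s * t : ℝ) ≠ 0 := by positivity
    exact_mod_cast h
  -- the fixed-point identity holds globally (both sides linear; the scalar identity s∕(1+st) = s(1 − t·s∕(1+st)))
  have hfix : ∀ᶠ x in 𝓝 (0 : Unit → ℂ), (𝔇 : (Unit → ℂ) → (Unit → ℂ)) x = 𝒞 (x - H (𝔇 x)) := by
    refine Filter.Eventually.of_forall fun x => funext fun u => ?_
    simp only [𝔇, 𝒞, H]
    push_cast
    simp
    field_simp
    ring
  have key := landauDerivative_decay (𝕜 := ℂ) (σ := Unit) (β := Unit) (𝔄 := ℂ) (fun _ _ : Unit => (0 : ℝ))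
    (fun _ _ _ => by simp) id id le_rfl H 𝔇.hasFDerivAt (𝒞.hasFDerivAt (x := 0 - H (𝔇 0))) hfix
    (fun _ _ => s * t) (fun _ _ => hst0)
    (fun c' a c => by
      simp [𝒞, H, Complex.norm_real, abs_of_nonneg hs, abs_of_nonneg ht]
      nlinarith [norm_nonneg a, mul_nonneg hs ht])
    (q := s * t) (fun c => by simp) hst () (ρ := s) (fun a c => by simp [𝒞, Complex.norm_real, abs_of_nonneg hs])
    a ()
  simpa [𝔇] using key

end Toy

end Summit.QuantumFields.BalabanUV.T4Continuum.ShellMeasureLandauDerivativeDecay
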